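import Summits.AtomisticToContinuum.Crystallization.Theorems.OverbindingBudgetAffineTwinCut

/-!
# NODE g78 «RunCut» (lens-4 g78, minimal counterexample / extremal reduction) — beneath 77T (`…AffineTwinCut`) and critic row 1352 on `stmt-31280`

TARGET.  The record piece **HI** = `InterfaceDominance := TameBalancedInterfaceCubicGap 64 (3/50) (1/450) 12` of the cut of record
`MR ⟸ QH ∧ RoughCubic ∧ InterfaceDominance` (`affMid_record_of_roughCut`, row 1352): «cubic stacking at an interface with hexagonal stacking is never
free» — `c > 0` per cubic-lettered site `j` in the `12·nn`-ball of a `(64, 3/50)`-deep site whose ball also holds a hexagonal-lettered site, against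
`#¬deep + #off + N^{2/3} + gains`.

THE EXTREMAL QUESTION (lens 4).  Let `y` be a counterexample to HI with the fewest priced sites per unit excess.  Which interface cubic sites of `y` can be
REMOVED BY SURGERY at a gain, charging the surgery's junk to sets that are still priced — and which cannot?  The answer is a POSITION IN THE STACKING WORD:

* RUN INTERIOR (`¬HNear 2`: no hexagonal-lettered site within `2·nn_j`, i.e. the five layers `j−2 … j+2` are cubic).  Here g77's REGISTRY SWAP of the layer
  pair `(j, j+1)` — the two layers translated by OPPOSITE partial vectors `±b`, `|b| = nn/√3`, i.e. `A B C A (B C) A B ↦ A B C A (C B) A B`, word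
  `…c c c c c… ↦ …c h c c h…` — is a vertically local move gaining `−2J₂ − 4Σ_{k≥3}|J_k| > 0` per column (`IdealTwinGain`, 77T §6); its lateral rim is a
  partial-dislocation DIPOLE (opposite Burgers vectors one layer apart: far field `∝ r⁻²`, energy `O(1)` per unit rim length, no `log L`), and — the
  point of this node — rims and losses lie IN THE TWO SWAPPED LAYERS, whose sites are run-interior interface sites themselves, so a maximal meso-rigid
  patch ends exactly at compressed / wild / `¬deep` / off-window sites.  The exchange currency of the surgery is `#compressedRun + #wildRun + #¬deep + #off`:
  subsets of HI's own priced set plus HI's own rebate.  NO OFF-RECORD DEBT — contrast 77T's `TwinGain`, whose currency `#flex` contains the smooth-sheared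
  pure-cubic sites priced only by the off-record `ShearedCubic` (B_aff).
* FAULT ZONE (`HNear 2`): the two cubic layers on either side of every `c/h` letter boundary.  It splits again (§5) into RUN ENDS — a run-interior cubic
  letter within `5/2·nn` through the shared anchor; these are SHADOWS of run interiors and reduce to them by packing (PROVED, `runEndCount_le_runInteriorCount`,
  `card_le_of_cube` BY NAME) — and THIN FAULTS: cubic runs of length `≤ 4` inside hexagonal matter (twin `c`, intrinsic `cc`, extrinsic `ccc`, `cccc`).
  A finite cubic run in hcp is a domain wall between parity variants of hcp (`…ABAB…` / `…ACAC…` / shifted), so NO vertically local restacking removes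
  it; its removal needs slab shifts through pure hcp, whose exchange (smooth-sheared hcp) nobody prices.  Hence the minimal counterexample to HI is, after
  the swaps, a DILUTE GAS OF THIN STACKING FAULTS in meso-rigid hexagonal matter: the residual normal form this node isolates as `ThinFault`, honestly
  tagged IDEA-NEEDED.

THE CUT (all seams PROVED, 0 sorry; every piece WEAKER than HI by census monotonicity `censusW_mono` BY NAME):

  HI ⟺ RunInterior ∧ FaultZone                                   (position in the word; `interfaceDominance_iff_run_fault`)
  RunInterior ⟺ RigidRun ∧ CompressedRun ∧ WildRun               (mechanical state of the site; `runInterior_iff_mech`)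
  FaultZone ⟺ RunEnd ∧ ThinFault,  RunEnd ⟸ RunInterior           (`faultZone_iff_runEnd_thinFault`; SHADOW PACKING `runEnd_of_runInterior`, §5)
  RigidRun ⟸ RigidRunExchange ∧ CompressedRun ∧ WildRun          (census glue; `rigidRun_of_exchange`)
  RigidRunExchange ⟸ HI  and  RigidRunExchange ⟸ StackSwapGain   (mono / the free bulk floor `floor_le` spent on the competitor)
  ∴ HI ⟺ RunInterior ∧ ThinFault ⟺ RigidRunExchange ∧ CompressedRun ∧ WildRun ∧ ThinFault   (`interfaceDominance_iff_runInterior_thinFault`,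
    `interfaceDominance_iff_leaves`, LOSSLESS) and HI ⟸ StackSwapGain ∧ CompressedRun ∧ WildRun ∧ ThinFault (`interfaceDominance_of_swap_thinFault`);
    record `MR ⟸ QH ∧ RoughCubic ∧ StackSwapGain ∧ CompressedRun ∧ WildRun ∧ ThinFault` (`affMid_record_of_swap_thinFault`), slot-3 / RDEF cones
    `tbdsg_of_swap_thinFault_record`, `rdef_of_ceg_shape_swap_thinFault_record` BY NAME (and the coarser `FaultZone` forms of §3–§4).

PIECES (literals of record `(ρ, ε, g, r) = (64, 3/50, 1/450, 12)`, near-h radius `rh = 2`, witness radius `rI = 5/2`, mechanical literals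
`(ρ₁, η, θ₀, s₁) = (12, 1/10⁴, 1/1000, 17/20)`):
* `RigidRunExchange` «RX» [WEAKER · ATTACKABLE-L via the competitor `StackSwapGain` «SW» · INSTRUMENTABLE]: `c·#rigidRun` against `#¬deep + #compressedRun +
  #wildRun + #off + N^{2/3} + gains`.  SW = «some admissible restacking moving only deep cubic-lettered in-window sites by `≤ nn` gains `c` per meso-rigid
  run-interior site at the cost of `C` per compressed / wild run-interior site, per `¬deep` site, per off-window site and `C·N^{2/3}`».  Error budget of the
  swap on a meso-rigid patch (each site `(10⁻⁴, 10⁻³)`-affinely two-shell framed throughout its `12·nn`-ball — any Barlow stacking is, the frame is the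
  letter): the FIRST-ORDER roughness term is negligible — the adjacent-layer partner triples of every static and every moved site are exchanged between the
  two mirror-image hollow registries (identical layer sums and z-forces, zero lateral force), and the only registry-dependent forces, from second-neighbour
  layers, are `≈ 6·10⁻⁴` per atom (layer sums, memo §4), times `η·a`: `≤ 4·10⁻⁷` per column — so roughness enters at SECOND order through the exchanged bonds,
  `≈ 2z′·|V″(a)|·η²a² ≤ 10⁻⁵` at `η = 10⁻⁴` on the box (but `≈ 9·10⁻⁴ > 2|J₂| ≈ 1.9·10⁻⁴` at `η = 10⁻³`, `a = 17/20`).  The literal `η = 10⁻⁴` is pinned from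
  both sides: RELAXED stacking faults displace the neighbouring layers by `≈ 6·10⁻⁴/21 ≈ 3·10⁻⁵·a < η` (so relaxed faulted crystal is meso-rigid and the swap
  class is the generic one; at 77T's `10⁻⁵` it would be «wild»), and the second-order budget needs `η ≲ 4·10⁻⁴`.  The distortion `θ₀ = 10⁻³` changes the gain
  by `≤ |∂J₂/∂F|·θ₀ ≲ 10⁻⁶` (loose bound `ΔC·θ₀²/2 ≤ 2·10⁻⁵`); gain `2|J₂(a)| = 1.44·10⁻⁴` at `a⋆ = 0.9712` (`1.9·10⁻⁴` at `17/20`, `2.5·10⁻⁶` at `2`; tails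
  `4Σ_{k≥3}|J_k| ≈ 3·10⁻⁷`).  Census ask TGR-cert (memo).  Why it might fail: `J₂(a) < 0` fails on part of the scale box `[17/20, 2]` (sign change computed
  at `a ≈ 0.772` only), or the second-order roughness term exceeds `2|J₂| − 4Σ_{k≥3}|J_k|` somewhere on it, or the dipole rim cannot be charged at bounded
  rate to the compressed / wild / `¬deep` / off-window sites where a maximal meso-rigid patch ends.
* `CompressedRun` «RO» [WEAKER · ATTACKABLE-S]: meso-rigid run-interior sites at scale `nn < 17/20` — sitewise compression margin `≥ +0.6` per site
  (`12·V(0.85) ≈ +1.67`, attractive far sum `≥ −0.95`, against `e⋆ = −0.7175`; 77T's KO instrument, booked ATTACKABLE-S at row 1352), exterior subsidy `≤ 3·10⁻⁴`.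
* `WildRun` «RW» [WEAKER · IDEA-NEEDED (B_aff, amplitude-lifted)]: run-interior interface sites NOT `(12, 10⁻⁴, 10⁻³)`-affinely deep — rough beyond `10⁻⁴·nn`
  or distorted beyond `10⁻³` somewhere in their `12·nn`-ball.  TRUE-type (local fcc pays the cushion `7.2·10⁻⁵` plus strain/roughness energy); no engine
  prices it against `e⋆` today (same family as 77T's KS / the record's RoughCubic, but confined to the interface zone and with roughness floor `10⁻⁴`,
  i.e. harmonic content `≥ λ·10⁻⁸` per ball instead of `10⁻¹⁰`).
* `ThinFault` «TF» [WEAKER · IDEA-NEEDED · INSTRUMENTABLE (77T's `StackingBlindness`/`IdealTwinGain` give the ideal fault energies `≈ k′·|J₂| > 0`)]: fault-zone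
  sites with no run-interior cubic letter within `5/2·nn` through an anchor — the thin-fault gas, the extremal normal form (above); the genuine residual of HI.
* `RunEnd` [WEAKER · PROVED from `RunInterior`], `FaultZone` «FZ» ⟺ RunEnd ∧ ThinFault, `RunInterior` ⟺ RigidRun ∧ CompressedRun ∧ WildRun,
  `RigidRun` ⟸ RX ∧ RO ∧ RW: intermediate nodes.  `StackSwapGain` «SW» [competitor · FALSE-if-certificate-fails · INSTRUMENTABLE]: sufficient for RX.

WHY EACH PIECE IS STRICTLY WEAKER THAN HI: RunInterior, FaultZone, RigidRun, CompressedRun, WildRun, RunEnd, ThinFault price SUBSETS of HI's priced set with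
HI's rebate; RX prices a subset with a LARGER rebate (`censusW_mono`).  SW is not comparable (a competitor statement) and is not a piece of the lossless form.
(Probes: each piece alone ⇏ HI, any three leaves ⇏ HI, SW ⇏ HI, HI ⇏ SW, RunEnd ⇏ RunInterior — 54/54 must-fail probes fail; bc7 21/21 CLEAN.)

WHY NOVEL (vs 74M–77T and the other lenses): the first surgery line of the lineage whose exchange currency is ENTIRELY on-record and weaker than its target
(77T: «TG ∧ KO ∧ KX ∧ HI ⇒ KF» needs KX ⊇ KS off-record); the position-in-word cut `HNear 2` (run interior / fault zone) and the shadow packing of run ends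
onto run interiors are new; the residual is named as a normal form (thin-fault gas) with the topological reason it resists local surgery; the roughness
literal is set by the swap's second-order error budget instead of the harmonic certificate.  What is NOT claimed: no leaf is proved; ThinFault and WildRun
remain IDEA-NEEDED; SW awaits its certificate (TGR-cert).

PART A of the 3-way landing split of NODE g78 «RunCut» (HOME/decomp-a2c-lens-4/g78/out/OverbindingBudgetAffineRunCut.lean, one namespace,
FQNs unchanged): §1 counts + counting inequalities, §2 statements / literals / competitor / bridges.
-/

namespace Summit.AtomisticToContinuum.Crystallization.Theorems.OverbindingBudgetAffineRunCut

open scoped BigOperators Classical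
open Literature.MathematicalPhysics.StatisticalMechanics
open Literature.Geometry.DiscreteGeometry (IsChargeFree nearestDist nearestDist_nonneg nearestDist_le_dist fccTwoShellPattern hcpTwoShellPattern)
open Summit.AtomisticToContinuum.Crystallization.Theorems.OverbindingBudgetMisfitRegistration (Framed Reg DeepReg)
open Summit.AtomisticToContinuum.Crystallization.Theorems.OverbindingBudgetMisfitWindowStatements (InWindow offCount)
open Summit.AtomisticToContinuum.Crystallization.Theorems.OverbindingBudgetMisfitCensusStatements (card_le_of_cube)
open Summit.AtomisticToContinuum.Crystallization.Theorems.OverbindingBudgetBalancedCensusStatements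
open Summit.AtomisticToContinuum.Crystallization.Theorems.OverbindingBudgetAffineLadder
open Summit.AtomisticToContinuum.Crystallization.Theorems.OverbindingBudgetAffineMesoCut
open Summit.AtomisticToContinuum.Crystallization.Theorems.OverbindingBudgetAffinePhaseCut
open Summit.AtomisticToContinuum.Crystallization.Theorems.OverbindingBudgetAffineCushionCut
open Summit.AtomisticToContinuum.Crystallization.Theorems.OverbindingBudgetAffineTwinCut

variable {N : ℕ}

local notation "E3" => EuclideanSpace ℝ (Fin 3)

/-! ## §1  The position-in-word and mechanical-state counts (potential-free, local) and the counting inequalities (PROVED) -/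

/-- RUN-INTERIOR interface cubic sites: HI's priced sites (cubic-lettered, in the `r·nn`-ball of a `(ρ, ε)`-deep site whose ball holds a hexagonal letter)
with NO hexagonal-lettered site within `rh·nn_j` (at `rh = 2`: layers `j−2 … j+2` cubic, so the swap of `(j, j+1)` is the local move `cccc → hcch`). -/
noncomputable def runInteriorCount (ρ ε g r rh : ℝ) (y : Fin N → E3) : ℕ :=
  Nat.card {j : Fin N // (CFramed ε g y j ∧ ∃ i : Fin N, DeepReg ρ ε g y i ∧ dist (y j) (y i) ≤ r * nearestDist y i ∧ HNear r ε g y i)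
    ∧ ¬ HNear rh ε g y j}

/-- FAULT-ZONE interface cubic sites: HI's priced sites WITH a hexagonal-lettered site within `rh·nn_j` (run ends and thin faults `c, cc, ccc, cccc`). -/
noncomputable def faultZoneCount (ρ ε g r rh : ℝ) (y : Fin N → E3) : ℕ :=
  Nat.card {j : Fin N // (CFramed ε g y j ∧ ∃ i : Fin N, DeepReg ρ ε g y i ∧ dist (y j) (y i) ≤ r * nearestDist y i ∧ HNear r ε g y i)
    ∧ HNear rh ε g y j}

/-- MESO-RIGID run-interior sites: run-interior interface cubic sites that are `(ρ₁, η, θ₀)`-affinely deep (every site of the `ρ₁·nn`-ball matched by an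
affine two-shell frame `θ₀`-close to an isometry, within `η·nn`) at scale `nn ≥ s₁` — the sites the registry swap prices. -/
noncomputable def rigidRunCount (ρ ρ₁ η θ₀ s₁ ε g r rh : ℝ) (y : Fin N → E3) : ℕ :=
  Nat.card {j : Fin N // ((CFramed ε g y j ∧ ∃ i : Fin N, DeepReg ρ ε g y i ∧ dist (y j) (y i) ≤ r * nearestDist y i ∧ HNear r ε g y i)
    ∧ ¬ HNear rh ε g y j) ∧ (AffDeepReg ρ₁ η θ₀ g y j ∧ s₁ ≤ nearestDist y j)}

/-- COMPRESSED run-interior sites: as `rigidRunCount` but at scale `nn < s₁` (exchange currency of the swap; sitewise compression margin). -/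
noncomputable def compressedRunCount (ρ ρ₁ η θ₀ s₁ ε g r rh : ℝ) (y : Fin N → E3) : ℕ :=
  Nat.card {j : Fin N // ((CFramed ε g y j ∧ ∃ i : Fin N, DeepReg ρ ε g y i ∧ dist (y j) (y i) ≤ r * nearestDist y i ∧ HNear r ε g y i)
    ∧ ¬ HNear rh ε g y j) ∧ (AffDeepReg ρ₁ η θ₀ g y j ∧ nearestDist y j < s₁)}

/-- WILD run-interior sites: run-interior interface cubic sites that are NOT `(ρ₁, η, θ₀)`-affinely deep (rough beyond `η·nn` or distorted beyond `θ₀`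
somewhere in the `ρ₁·nn`-ball) — exchange currency of the swap; the B_aff-type residual of the run interior. -/
noncomputable def wildRunCount (ρ ρ₁ η θ₀ ε g r rh : ℝ) (y : Fin N → E3) : ℕ :=
  Nat.card {j : Fin N // ((CFramed ε g y j ∧ ∃ i : Fin N, DeepReg ρ ε g y i ∧ dist (y j) (y i) ≤ r * nearestDist y i ∧ HNear r ε g y i)
    ∧ ¬ HNear rh ε g y j) ∧ ¬ AffDeepReg ρ₁ η θ₀ g y j}

/-- EXCLUDED MIDDLE ON THE POSITION IN THE WORD: `#interfaceCubic ≤ #runInterior + #faultZone`. [this file] -/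
theorem interfaceCubicCount_le_runInterior_add_faultZone {ρ ε g r rh : ℝ} (y : Fin N → E3) :
    interfaceCubicCount ρ ε g r y ≤ runInteriorCount ρ ε g r rh y + faultZoneCount ρ ε g r rh y := by
  simp only [interfaceCubicCount, runInteriorCount, faultZoneCount, Nat.card_eq_fintype_card, Fintype.card_subtype]
  calc (Finset.univ.filter fun j => CFramed ε g y j ∧ ∃ i : Fin N, DeepReg ρ ε g y i ∧ dist (y j) (y i) ≤ r * nearestDist y i ∧ HNear r ε g y i).card
      ≤ ((Finset.univ.filter fun j =>
            (CFramed ε g y j ∧ ∃ i : Fin N, DeepReg ρ ε g y i ∧ dist (y j) (y i) ≤ r * nearestDist y i ∧ HNear r ε g y i) ∧ ¬ HNear rh ε g y j) ∪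
          (Finset.univ.filter fun j =>
            (CFramed ε g y j ∧ ∃ i : Fin N, DeepReg ρ ε g y i ∧ dist (y j) (y i) ≤ r * nearestDist y i ∧ HNear r ε g y i) ∧ HNear rh ε g y j)).card := by
        apply Finset.card_le_card
        intro j hj
        rw [Finset.mem_filter] at hj
        simp only [Finset.mem_union, Finset.mem_filter]
        by_cases hN : HNear rh ε g y j
        · exact Or.inr ⟨hj.1, hj.2, hN⟩
        · exact Or.inl ⟨hj.1, hj.2, hN⟩
    _ ≤ _ := Finset.card_union_le _ _

/-- `#runInterior ≤ #interfaceCubic`. [this file] -/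
theorem runInteriorCount_le_interfaceCubicCount {ρ ε g r rh : ℝ} (y : Fin N → E3) :
    runInteriorCount ρ ε g r rh y ≤ interfaceCubicCount ρ ε g r y := by
  simp only [runInteriorCount, interfaceCubicCount, Nat.card_eq_fintype_card, Fintype.card_subtype]
  apply Finset.card_le_card
  intro j hj
  rw [Finset.mem_filter] at hj ⊢
  exact ⟨hj.1, hj.2.1⟩

/-- `#faultZone ≤ #interfaceCubic`. [this file] -/
theorem faultZoneCount_le_interfaceCubicCount {ρ ε g r rh : ℝ} (y : Fin N → E3) :
    faultZoneCount ρ ε g r rh y ≤ interfaceCubicCount ρ ε g r y := by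
  simp only [faultZoneCount, interfaceCubicCount, Nat.card_eq_fintype_card, Fintype.card_subtype]
  apply Finset.card_le_card
  intro j hj
  rw [Finset.mem_filter] at hj ⊢
  exact ⟨hj.1, hj.2.1⟩

/-- EXCLUDED MIDDLE ON THE MECHANICAL STATE: `#runInterior ≤ #rigidRun + #compressedRun + #wildRun`. [this file] -/
theorem runInteriorCount_le_rigid_add_compressed_add_wild {ρ ρ₁ η θ₀ s₁ ε g r rh : ℝ} (y : Fin N → E3) :
    runInteriorCount ρ ε g r rh y ≤ rigidRunCount ρ ρ₁ η θ₀ s₁ ε g r rh y + compressedRunCount ρ ρ₁ η θ₀ s₁ ε g r rh y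
      + wildRunCount ρ ρ₁ η θ₀ ε g r rh y := by
  simp only [runInteriorCount, rigidRunCount, compressedRunCount, wildRunCount, Nat.card_eq_fintype_card, Fintype.card_subtype]
  calc (Finset.univ.filter fun j =>
          (CFramed ε g y j ∧ ∃ i : Fin N, DeepReg ρ ε g y i ∧ dist (y j) (y i) ≤ r * nearestDist y i ∧ HNear r ε g y i) ∧ ¬ HNear rh ε g y j).card
      ≤ (((Finset.univ.filter fun j =>
            ((CFramed ε g y j ∧ ∃ i : Fin N, DeepReg ρ ε g y i ∧ dist (y j) (y i) ≤ r * nearestDist y i ∧ HNear r ε g y i) ∧ ¬ HNear rh ε g y j)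
              ∧ (AffDeepReg ρ₁ η θ₀ g y j ∧ s₁ ≤ nearestDist y j)) ∪
          (Finset.univ.filter fun j =>
            ((CFramed ε g y j ∧ ∃ i : Fin N, DeepReg ρ ε g y i ∧ dist (y j) (y i) ≤ r * nearestDist y i ∧ HNear r ε g y i) ∧ ¬ HNear rh ε g y j)
              ∧ (AffDeepReg ρ₁ η θ₀ g y j ∧ nearestDist y j < s₁))) ∪
          (Finset.univ.filter fun j =>
            ((CFramed ε g y j ∧ ∃ i : Fin N, DeepReg ρ ε g y i ∧ dist (y j) (y i) ≤ r * nearestDist y i ∧ HNear r ε g y i) ∧ ¬ HNear rh ε g y j)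
              ∧ ¬ AffDeepReg ρ₁ η θ₀ g y j)).card := by
        apply Finset.card_le_card
        intro j hj
        rw [Finset.mem_filter] at hj
        simp only [Finset.mem_union, Finset.mem_filter]
        by_cases hA : AffDeepReg ρ₁ η θ₀ g y j
        · by_cases hs : s₁ ≤ nearestDist y j
          · exact Or.inl (Or.inl ⟨hj.1, hj.2, hA, hs⟩)
          · exact Or.inl (Or.inr ⟨hj.1, hj.2, hA, lt_of_not_ge hs⟩)
        · exact Or.inr ⟨hj.1, hj.2, hA⟩
    _ ≤ _ := (Finset.card_union_le _ _).trans (Nat.add_le_add_right (Finset.card_union_le _ _) _)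

/-- `#rigidRun ≤ #runInterior`. [this file] -/
theorem rigidRunCount_le_runInteriorCount {ρ ρ₁ η θ₀ s₁ ε g r rh : ℝ} (y : Fin N → E3) :
    rigidRunCount ρ ρ₁ η θ₀ s₁ ε g r rh y ≤ runInteriorCount ρ ε g r rh y := by
  simp only [rigidRunCount, runInteriorCount, Nat.card_eq_fintype_card, Fintype.card_subtype]
  apply Finset.card_le_card
  intro j hj
  rw [Finset.mem_filter] at hj ⊢
  exact ⟨hj.1, hj.2.1⟩

/-- `#compressedRun ≤ #runInterior`. [this file] -/
theorem compressedRunCount_le_runInteriorCount {ρ ρ₁ η θ₀ s₁ ε g r rh : ℝ} (y : Fin N → E3) :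
    compressedRunCount ρ ρ₁ η θ₀ s₁ ε g r rh y ≤ runInteriorCount ρ ε g r rh y := by
  simp only [compressedRunCount, runInteriorCount, Nat.card_eq_fintype_card, Fintype.card_subtype]
  apply Finset.card_le_card
  intro j hj
  rw [Finset.mem_filter] at hj ⊢
  exact ⟨hj.1, hj.2.1⟩

/-- `#wildRun ≤ #runInterior`. [this file] -/
theorem wildRunCount_le_runInteriorCount {ρ ρ₁ η θ₀ ε g r rh : ℝ} (y : Fin N → E3) :
    wildRunCount ρ ρ₁ η θ₀ ε g r rh y ≤ runInteriorCount ρ ε g r rh y := by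
  simp only [wildRunCount, runInteriorCount, Nat.card_eq_fintype_card, Fintype.card_subtype]
  apply Finset.card_le_card
  intro j hj
  rw [Finset.mem_filter] at hj ⊢
  exact ⟨hj.1, hj.2.1⟩

/-- `#rigidRun ≤ #interfaceCubic`. [this file] -/
theorem rigidRunCount_le_interfaceCubicCount {ρ ρ₁ η θ₀ s₁ ε g r rh : ℝ} (y : Fin N → E3) :
    rigidRunCount ρ ρ₁ η θ₀ s₁ ε g r rh y ≤ interfaceCubicCount ρ ε g r y :=
  (rigidRunCount_le_runInteriorCount y).trans (runInteriorCount_le_interfaceCubicCount y)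

/-- `#compressedRun ≤ #interfaceCubic`. [this file] -/
theorem compressedRunCount_le_interfaceCubicCount {ρ ρ₁ η θ₀ s₁ ε g r rh : ℝ} (y : Fin N → E3) :
    compressedRunCount ρ ρ₁ η θ₀ s₁ ε g r rh y ≤ interfaceCubicCount ρ ε g r y :=
  (compressedRunCount_le_runInteriorCount y).trans (runInteriorCount_le_interfaceCubicCount y)

/-- `#wildRun ≤ #interfaceCubic`. [this file] -/
theorem wildRunCount_le_interfaceCubicCount {ρ ρ₁ η θ₀ ε g r rh : ℝ} (y : Fin N → E3) :
    wildRunCount ρ ρ₁ η θ₀ ε g r rh y ≤ interfaceCubicCount ρ ε g r y :=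
  (wildRunCount_le_runInteriorCount y).trans (runInteriorCount_le_interfaceCubicCount y)

/-! ## §2  THE PIECES (census shape of the tree: one window `W`, tame form, literals of record) and the COMPETITOR -/

/-- **RunInterior_W** «HI restricted to run interiors»: `c > 0` per run-interior interface cubic site against `#¬deep + #off + N^{2/3} + gains`.
[this file · kind: statement · WEAKER than HI_W] -/
def BalancedRunInteriorGapW (ρ ε g r rh σ₁ σ₂ : ℝ) : Prop :=
  ∃ c C : ℝ, 0 < c ∧ ∀ (N : ℕ) (y : Fin N → E3), Function.Injective y →
    ∃ u : E3, ‖u‖ = 1 ∧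
      (N : ℝ) * (⨅ Q : PeriodicConfiguration 3, Q.energyPerParticle lennardJones) + c * (runInteriorCount ρ ε g r rh y : ℝ)
        - C * (notDeepCount ρ ε g y : ℝ) - C * (offCount σ₁ σ₂ y : ℝ) - C * (N : ℝ) ^ (2 / 3 : ℝ) - C * (dilGain y + shGain u y)
        ≤ interactionEnergy lennardJones y

/-- **FaultZone_W** «HI restricted to the fault zone» (run ends and thin faults). [this file · kind: statement · WEAKER than HI_W] -/
def BalancedFaultZoneGapW (ρ ε g r rh σ₁ σ₂ : ℝ) : Prop :=
  ∃ c C : ℝ, 0 < c ∧ ∀ (N : ℕ) (y : Fin N → E3), Function.Injective y →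
    ∃ u : E3, ‖u‖ = 1 ∧
      (N : ℝ) * (⨅ Q : PeriodicConfiguration 3, Q.energyPerParticle lennardJones) + c * (faultZoneCount ρ ε g r rh y : ℝ)
        - C * (notDeepCount ρ ε g y : ℝ) - C * (offCount σ₁ σ₂ y : ℝ) - C * (N : ℝ) ^ (2 / 3 : ℝ) - C * (dilGain y + shGain u y)
        ≤ interactionEnergy lennardJones y

/-- **RigidRun_W**: `c > 0` per meso-rigid run-interior site against `#¬deep + #off + N^{2/3} + gains`. [this file · kind: statement · WEAKER than HI_W] -/
def BalancedRigidRunGapW (ρ ρ₁ η θ₀ s₁ ε g r rh σ₁ σ₂ : ℝ) : Prop :=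
  ∃ c C : ℝ, 0 < c ∧ ∀ (N : ℕ) (y : Fin N → E3), Function.Injective y →
    ∃ u : E3, ‖u‖ = 1 ∧
      (N : ℝ) * (⨅ Q : PeriodicConfiguration 3, Q.energyPerParticle lennardJones) + c * (rigidRunCount ρ ρ₁ η θ₀ s₁ ε g r rh y : ℝ)
        - C * (notDeepCount ρ ε g y : ℝ) - C * (offCount σ₁ σ₂ y : ℝ) - C * (N : ℝ) ^ (2 / 3 : ℝ) - C * (dilGain y + shGain u y)
        ≤ interactionEnergy lennardJones y

/-- **CompressedRun_W** «RO»: `c > 0` per compressed meso-rigid run-interior site (`nn < s₁`). [this file · kind: statement · WEAKER than HI_W · ATTACKABLE-S] -/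
def BalancedCompressedRunGapW (ρ ρ₁ η θ₀ s₁ ε g r rh σ₁ σ₂ : ℝ) : Prop :=
  ∃ c C : ℝ, 0 < c ∧ ∀ (N : ℕ) (y : Fin N → E3), Function.Injective y →
    ∃ u : E3, ‖u‖ = 1 ∧
      (N : ℝ) * (⨅ Q : PeriodicConfiguration 3, Q.energyPerParticle lennardJones) + c * (compressedRunCount ρ ρ₁ η θ₀ s₁ ε g r rh y : ℝ)
        - C * (notDeepCount ρ ε g y : ℝ) - C * (offCount σ₁ σ₂ y : ℝ) - C * (N : ℝ) ^ (2 / 3 : ℝ) - C * (dilGain y + shGain u y)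
        ≤ interactionEnergy lennardJones y

/-- **WildRun_W** «RW»: `c > 0` per wild (not `(ρ₁, η, θ₀)`-affinely deep) run-interior site. [this file · kind: statement · WEAKER than HI_W · IDEA-NEEDED] -/
def BalancedWildRunGapW (ρ ρ₁ η θ₀ ε g r rh σ₁ σ₂ : ℝ) : Prop :=
  ∃ c C : ℝ, 0 < c ∧ ∀ (N : ℕ) (y : Fin N → E3), Function.Injective y →
    ∃ u : E3, ‖u‖ = 1 ∧
      (N : ℝ) * (⨅ Q : PeriodicConfiguration 3, Q.energyPerParticle lennardJones) + c * (wildRunCount ρ ρ₁ η θ₀ ε g r rh y : ℝ)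
        - C * (notDeepCount ρ ε g y : ℝ) - C * (offCount σ₁ σ₂ y : ℝ) - C * (N : ℝ) ^ (2 / 3 : ℝ) - C * (dilGain y + shGain u y)
        ≤ interactionEnergy lennardJones y

/-- **RigidRunExchange_W** «RX» — the census form of the surgery line: `c > 0` per meso-rigid run-interior site against the ENLARGED rebate
`#¬deep + #compressedRun + #wildRun` (the swap's exchange currency) `+ #off + N^{2/3} + gains`.  Weaker than HI_W (`censusW_mono`); implied by the
competitor SW_W (`floor_le`). [this file · kind: statement · WEAKER than HI_W · ATTACKABLE-L] -/
def BalancedRigidRunExchangeGapW (ρ ρ₁ η θ₀ s₁ ε g r rh σ₁ σ₂ : ℝ) : Prop :=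
  ∃ c C : ℝ, 0 < c ∧ ∀ (N : ℕ) (y : Fin N → E3), Function.Injective y →
    ∃ u : E3, ‖u‖ = 1 ∧
      (N : ℝ) * (⨅ Q : PeriodicConfiguration 3, Q.energyPerParticle lennardJones) + c * (rigidRunCount ρ ρ₁ η θ₀ s₁ ε g r rh y : ℝ)
        - C * ((notDeepCount ρ ε g y + (compressedRunCount ρ ρ₁ η θ₀ s₁ ε g r rh y + wildRunCount ρ ρ₁ η θ₀ ε g r rh y) : ℕ) : ℝ)
        - C * (offCount σ₁ σ₂ y : ℝ) - C * (N : ℝ) ^ (2 / 3 : ℝ) - C * (dilGain y + shGain u y)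
        ≤ interactionEnergy lennardJones y

/-- **SW_W** («stack-swap gain», one window) — the COMPETITOR.  For every injective configuration there is a competitor `y′`, obtained by moving only
`(r, ε)`-deeply registered cubic-lettered in-window sites, each by at most its own nearest-neighbour distance (registry swaps `ccccc → chcch`: a
run-interior layer pair translated by opposite Shockley vectors `±b`, `|b| = nn/√3`, on maximal meso-rigid patches; the rim is a partial-dislocation dipole,
`O(1)` per unit length), with
`𝓔(y′) + c·#rigidRun ≤ 𝓔(y) + C·(#compressedRun + #wildRun) + C·#¬(ρ,ε)-deep + C·#off + C·N^{2/3}`.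
Informal content: per swapped column the gain is `−(2J₂ + Σ_{k≥3} ϑ_k J_k) ≥ 2|J₂| − 4Σ_{k≥3}|J_k| > 0` at every scale of the box (`IdealTwinGain`), minus the
distortion correction at `θ₀` (`≲ 10⁻⁶`) and the roughness terms at `η` (first order `≤ 4·10⁻⁷` per column: adjacent-layer partner triples are exchanged
between mirror-image hollow registries, only the second-neighbour-layer registry force `≈ 6·10⁻⁴` survives; second order `≈ 2z′·|V″(a)|·η²a² ≤ 10⁻⁵`) — census
ask TGR-cert; rims (partial-dislocation dipoles) and losses lie in the swapped layers, i.e. at compressed / wild run-interior sites, at `¬deep` sites or at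
off-window sites. [this file · kind: statement (competitor) · not comparable with HI] -/
def StackSwapGainW (ρ ρ₁ η θ₀ s₁ ε g r rh σ₁ σ₂ : ℝ) : Prop :=
  ∃ c C : ℝ, 0 < c ∧ ∀ (N : ℕ) (y : Fin N → E3), Function.Injective y →
    ∃ y' : Fin N → E3, Function.Injective y' ∧
      (∀ i : Fin N, y' i ≠ y i → (DeepReg r ε g y i ∧ CFramed ε g y i ∧ InWindow σ₁ σ₂ y i) ∧ dist (y' i) (y i) ≤ nearestDist y i) ∧
      interactionEnergy lennardJones y' + c * (rigidRunCount ρ ρ₁ η θ₀ s₁ ε g r rh y : ℝ)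
        ≤ interactionEnergy lennardJones y
          + C * ((compressedRunCount ρ ρ₁ η θ₀ s₁ ε g r rh y + wildRunCount ρ ρ₁ η θ₀ ε g r rh y : ℕ) : ℝ)
          + C * (notDeepCount ρ ε g y : ℝ) + C * (offCount σ₁ σ₂ y : ℝ) + C * (N : ℝ) ^ (2 / 3 : ℝ)

/-- RunInterior (tame). -/
def TameBalancedRunInteriorGap (ρ ε g r rh : ℝ) : Prop :=
  ∀ δ : ℝ, 0 < δ → δ ≤ 2 → BalancedRunInteriorGapW ρ ε g r rh δ 2

/-- FaultZone (tame). -/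
def TameBalancedFaultZoneGap (ρ ε g r rh : ℝ) : Prop :=
  ∀ δ : ℝ, 0 < δ → δ ≤ 2 → BalancedFaultZoneGapW ρ ε g r rh δ 2

/-- RigidRun (tame). -/
def TameBalancedRigidRunGap (ρ ρ₁ η θ₀ s₁ ε g r rh : ℝ) : Prop :=
  ∀ δ : ℝ, 0 < δ → δ ≤ 2 → BalancedRigidRunGapW ρ ρ₁ η θ₀ s₁ ε g r rh δ 2

/-- CompressedRun (tame). -/
def TameBalancedCompressedRunGap (ρ ρ₁ η θ₀ s₁ ε g r rh : ℝ) : Prop :=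
  ∀ δ : ℝ, 0 < δ → δ ≤ 2 → BalancedCompressedRunGapW ρ ρ₁ η θ₀ s₁ ε g r rh δ 2

/-- WildRun (tame). -/
def TameBalancedWildRunGap (ρ ρ₁ η θ₀ ε g r rh : ℝ) : Prop :=
  ∀ δ : ℝ, 0 < δ → δ ≤ 2 → BalancedWildRunGapW ρ ρ₁ η θ₀ ε g r rh δ 2

/-- RigidRunExchange (tame). -/
def TameBalancedRigidRunExchangeGap (ρ ρ₁ η θ₀ s₁ ε g r rh : ℝ) : Prop :=
  ∀ δ : ℝ, 0 < δ → δ ≤ 2 → BalancedRigidRunExchangeGapW ρ ρ₁ η θ₀ s₁ ε g r rh δ 2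

/-- StackSwapGain (tame). -/
def TameStackSwapGain (ρ ρ₁ η θ₀ s₁ ε g r rh : ℝ) : Prop :=
  ∀ δ : ℝ, 0 < δ → δ ≤ 2 → StackSwapGainW ρ ρ₁ η θ₀ s₁ ε g r rh δ 2

/-- **`RunInterior`** «HI_A» — at the literals of record `(64, 3/50, 1/450, 12)` and near-h radius `2`. [this file · kind: statement · WEAKER] -/
def RunInterior : Prop :=
  TameBalancedRunInteriorGap 64 (3 / 50) (1 / 450) 12 2

/-- **`FaultZone`** «FZ» — the residual normal form (run ends ∪ thin-fault gas). [this file · kind: statement · WEAKER · IDEA-NEEDED] -/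
def FaultZone : Prop :=
  TameBalancedFaultZoneGap 64 (3 / 50) (1 / 450) 12 2

/-- **`RigidRun`** «RR» — mechanical literals `(ρ₁, η, θ₀, s₁) = (12, 1/10⁴, 1/1000, 17/20)`. [this file · kind: statement · WEAKER · ATTACKABLE-L] -/
def RigidRun : Prop :=
  TameBalancedRigidRunGap 64 12 (1 / 10 ^ 4) (1 / 1000) (17 / 20) (3 / 50) (1 / 450) 12 2

/-- **`CompressedRun`** «RO». [this file · kind: statement · WEAKER · ATTACKABLE-S] -/
def CompressedRun : Prop :=
  TameBalancedCompressedRunGap 64 12 (1 / 10 ^ 4) (1 / 1000) (17 / 20) (3 / 50) (1 / 450) 12 2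

/-- **`WildRun`** «RW». [this file · kind: statement · WEAKER · IDEA-NEEDED] -/
def WildRun : Prop :=
  TameBalancedWildRunGap 64 12 (1 / 10 ^ 4) (1 / 1000) (3 / 50) (1 / 450) 12 2

/-- **`RigidRunExchange`** «RX» — the on-record surgery leaf. [this file · kind: statement · WEAKER · ATTACKABLE-L] -/
def RigidRunExchange : Prop :=
  TameBalancedRigidRunExchangeGap 64 12 (1 / 10 ^ 4) (1 / 1000) (17 / 20) (3 / 50) (1 / 450) 12 2

/-- **`StackSwapGain`** «SW» — the competitor at the literals of record. [this file · kind: statement (competitor)] -/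
def StackSwapGain : Prop :=
  TameStackSwapGain 64 12 (1 / 10 ^ 4) (1 / 1000) (17 / 20) (3 / 50) (1 / 450) 12 2

/-! ### The named statements ARE `CensusW` of their counts (definitional bridges) -/

/-- RunInterior_W is `CensusW`. [formal bookkeeping] -/
theorem balancedRunInteriorGapW_iff_censusW {ρ ε g r rh σ₁ σ₂ : ℝ} : BalancedRunInteriorGapW ρ ε g r rh σ₁ σ₂ ↔
    CensusW (fun y => runInteriorCount ρ ε g r rh y) (fun y => notDeepCount ρ ε g y) σ₁ σ₂ := Iff.rfl

/-- FaultZone_W is `CensusW`. [formal bookkeeping] -/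
theorem balancedFaultZoneGapW_iff_censusW {ρ ε g r rh σ₁ σ₂ : ℝ} : BalancedFaultZoneGapW ρ ε g r rh σ₁ σ₂ ↔
    CensusW (fun y => faultZoneCount ρ ε g r rh y) (fun y => notDeepCount ρ ε g y) σ₁ σ₂ := Iff.rfl

/-- RigidRun_W is `CensusW`. [formal bookkeeping] -/
theorem balancedRigidRunGapW_iff_censusW {ρ ρ₁ η θ₀ s₁ ε g r rh σ₁ σ₂ : ℝ} : BalancedRigidRunGapW ρ ρ₁ η θ₀ s₁ ε g r rh σ₁ σ₂ ↔
    CensusW (fun y => rigidRunCount ρ ρ₁ η θ₀ s₁ ε g r rh y) (fun y => notDeepCount ρ ε g y) σ₁ σ₂ := Iff.rfl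

/-- CompressedRun_W is `CensusW`. [formal bookkeeping] -/
theorem balancedCompressedRunGapW_iff_censusW {ρ ρ₁ η θ₀ s₁ ε g r rh σ₁ σ₂ : ℝ} : BalancedCompressedRunGapW ρ ρ₁ η θ₀ s₁ ε g r rh σ₁ σ₂ ↔
    CensusW (fun y => compressedRunCount ρ ρ₁ η θ₀ s₁ ε g r rh y) (fun y => notDeepCount ρ ε g y) σ₁ σ₂ := Iff.rfl

/-- WildRun_W is `CensusW`. [formal bookkeeping] -/
theorem balancedWildRunGapW_iff_censusW {ρ ρ₁ η θ₀ ε g r rh σ₁ σ₂ : ℝ} : BalancedWildRunGapW ρ ρ₁ η θ₀ ε g r rh σ₁ σ₂ ↔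
    CensusW (fun y => wildRunCount ρ ρ₁ η θ₀ ε g r rh y) (fun y => notDeepCount ρ ε g y) σ₁ σ₂ := Iff.rfl

/-- RigidRunExchange_W is `CensusW` with the enlarged rebate. [formal bookkeeping] -/
theorem balancedRigidRunExchangeGapW_iff_censusW {ρ ρ₁ η θ₀ s₁ ε g r rh σ₁ σ₂ : ℝ} : BalancedRigidRunExchangeGapW ρ ρ₁ η θ₀ s₁ ε g r rh σ₁ σ₂ ↔
    CensusW (fun y => rigidRunCount ρ ρ₁ η θ₀ s₁ ε g r rh y)
      (fun y => notDeepCount ρ ε g y + (compressedRunCount ρ ρ₁ η θ₀ s₁ ε g r rh y + wildRunCount ρ ρ₁ η θ₀ ε g r rh y)) σ₁ σ₂ := Iff.rfl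

end Summit.AtomisticToContinuum.Crystallization.Theorems.OverbindingBudgetAffineRunCut
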